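import Literature.NumberTheory.Automorphic.GLnCongruenceSubgroups
import Literature.NumberTheory.Automorphic.CartanDecompositionGLnPowers
import HarnessLib

/-!
# Principal congruence subgroups of `GL_n(F)`: normality, the `K_m`, the expansion property
`ϖ^a K_m ϖ^b ⊆ K_m ϖ^{a+b} K_m`, and `GL_n(F)` is a nonarchimedean group

Topic `NumberTheory/Automorphic`; theorems only (no definition, no named fact), on top of
`GLnCongruenceSubgroups` (the principal congruence subgroups `congruenceGL n γ`, their topology,
inversion of matrices `≡ 1 mod 𝓂`) and `CartanDecompositionGLnPowers` (torus elements
`ϖ^a = zpowDiagGL`, uniformizing elements). Setting: a field `F` with a `ValuativeRel`, later a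
non-archimedean local field, `K = GL_n(𝒪) = glInt n F`, `ϖ` a uniformizing element
(`IsUniformizingElement`) and `K_m = congruenceGL n |ϖ|^m = 1 + ϖ^m M_n(𝒪)` (`m ≥ 1`).

* `conj_mem_congruenceGL`: the `congruenceGL n γ` are **normal in `GL_n(𝒪)`**.
* `exists_eq_one_add_smul_of_mem_congruenceGL`, `mem_congruenceGL_of_coe_eq_one_add_smul`:
  `K_m = {1 + ϖ^m X : X ∈ M_n(𝒪)}` for `m ≥ 1`.
* `conj_zpowDiagGL_mem_congruenceGL`: `ϖ^a (1 + ϖ^{m+e} W) ϖ^{-a} ∈ K_m` when `a_j ≤ a_i + e`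
  wherever `W_{ij} ≠ 0`.
* `exists_zpowDiagGL_mul_mul_zpowDiagGL_eq_of_mem_congruenceGL` (**expansion property at level
  `m`**): for `α, β ∈ ℤⁿ` antitone (dominant for the upper Borel), `α` of spread `≤ m`
  (`α_j ≤ α_i + m`), and `k ∈ K_m`: `ϖ^α k ϖ^β ∈ K_m (ϖ^α ϖ^β) K_m`. Unlike the level-one case
  (`CongruenceSubgroupFactorization.exists_zpowDiagGL_mul_mul_zpowDiagGL_eq`, through the full
  upper × lower factorisation of `K₁`) the proof is a **one-step splitting**
  `k = k₃ x y`, `x = 1 + ϖ^m X_{≤}` (upper part), `y = 1 + ϖ^m X_{>}` (strictly lower part),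
  `k₃ = k y⁻¹ x⁻¹ ∈ K_{2m}`, after which `ϖ^α k ϖ^β = (ϖ^α k₃ ϖ^{-α})(ϖ^α x ϖ^{-α}) · ϖ^α ϖ^β ·
  (ϖ^{-β} y ϖ^β)` with all three conjugates in `K_m`; the spread condition on `α` is what absorbs
  the error term `k₃` (Casselman (1995), Prop. 1.4.4 and Lemma 4.1.5; Bernstein–Zelevinsky
  (1976), §3). This is the input for the multiplicativity of the operators `e_{K_m} π(t)` along
  generators of the dominant cone (`HeckeProjectorGrowth`, `GodementJacquetLocalConvergenceProofs`).
* `exists_congruenceGL_pow_subset`, `nonarchimedeanGroup_gl`: the `K_m` form a neighbourhood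
  basis of `1`, so **`GL_n(F)` is a nonarchimedean topological group** (a theorem to be invoked
  with `haveI`, not an instance).

## References

* W. Casselman, *Introduction to the theory of admissible representations of 𝔭-adic reductive
  groups* (1995 notes), Prop. 1.4.4, Lemma 4.1.5.
* I. N. Bernstein, A. V. Zelevinsky, *Representations of the group `GL(n, F)` where `F` is a
  non-archimedean local field*, Russian Math. Surveys 31:3 (1976), §3 [BernsteinZelevinsky1976].
* D. Bump, *Automorphic Forms and Representations* (1997), Prop. 4.2.1 (compact open subgroups
  form a neighbourhood basis) [Bump1997].
-/

set_option autoImplicit false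

noncomputable section

open scoped MatrixGroups
open Matrix ValuativeRel

namespace Literature.NumberTheory.Automorphic

variable {F : Type*} [Field F] [ValuativeRel F] {n : ℕ}

/-! ### Normality of the principal congruence subgroups in `GL_n(𝒪)` -/

/-- Elements of `GL_n(𝒪)` have entries of valuation `≤ 1` (`ValBound 1`). [folklore] -/
theorem valBound_one_of_mem_glInt {g : GL (Fin n) F} (hg : g ∈ glInt n F) :
    ValBound 1 (g : Matrix (Fin n) (Fin n) F) :=
  fun i j => valuation_apply_le_one_of_mem_glInt hg i j

/-- Conjugating by `κ ∈ GL_n(𝒪)` preserves the congruence `k ≡ 1`: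
`κ k κ⁻¹ - 1 = κ (k - 1) κ⁻¹` has entries of valuation `≤ γ` if `k - 1` has. [folklore] -/
theorem valBound_coe_conj_sub_one {γ : ValueGroupWithZero F} {κ k : GL (Fin n) F}
    (hκ : κ ∈ glInt n F) (hk : ValBound γ ((k : Matrix (Fin n) (Fin n) F) - 1)) :
    ValBound γ (((κ * k * κ⁻¹ : GL (Fin n) F) : Matrix (Fin n) (Fin n) F) - 1) := by
  have e : (((κ * k * κ⁻¹ : GL (Fin n) F) : Matrix (Fin n) (Fin n) F) - 1) =
      (κ : Matrix (Fin n) (Fin n) F) * ((k : Matrix (Fin n) (Fin n) F) - 1) *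
        ((κ⁻¹ : GL (Fin n) F) : Matrix (Fin n) (Fin n) F) := by
    rw [Matrix.mul_sub, Matrix.sub_mul, Matrix.mul_one, Units.val_mul, Units.val_mul,
      Matrix.mul_assoc (κ : Matrix (Fin n) (Fin n) F) (k : Matrix (Fin n) (Fin n) F),
      ← Units.val_mul, ← Units.val_mul, ← Units.val_mul, mul_inv_cancel, Units.val_one]
  rw [e]
  have h := ((valBound_one_of_mem_glInt hκ).mul hk).mul
    (valBound_one_of_mem_glInt (Subgroup.inv_mem _ hκ))
  rwa [one_mul, mul_one] at h

/-- **The principal congruence subgroups are normal in `GL_n(𝒪)`**: `κ k κ⁻¹ ∈ congruenceGL n γ`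
for `κ ∈ GL_n(𝒪)` and `k ∈ congruenceGL n γ`. (Bernstein–Zelevinsky (1976), §3; Casselman
(1995), §1.4.) [folklore] -/
theorem conj_mem_congruenceGL {γ : ValueGroupWithZero F} {κ : GL (Fin n) F} (hκ : κ ∈ glInt n F)
    {k : GL (Fin n) F} (hk : k ∈ congruenceGL n γ) : κ * k * κ⁻¹ ∈ congruenceGL n γ := by
  have hmem : κ * k * κ⁻¹ ∈ glInt n F :=
    Subgroup.mul_mem _ (Subgroup.mul_mem _ hκ (congruenceGL_le_glInt _ hk)) (Subgroup.inv_mem _ hκ)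
  refine ⟨⟨valBound_one_of_mem_glInt hmem, valBound_one_of_mem_glInt (Subgroup.inv_mem _ hmem)⟩,
    valBound_coe_conj_sub_one hκ hk.2.1, ?_⟩
  have e : (κ * k * κ⁻¹)⁻¹ = κ * k⁻¹ * κ⁻¹ := by group
  rw [e]
  exact valBound_coe_conj_sub_one hκ hk.2.2

/-! ### The principal congruence subgroups `K_m = 1 + ϖ^m M_n(𝒪)` -/

section Uniformizer

variable {ϖ : F}

/-- `|ϖ|^m < 1` for `m ≥ 1`. [folklore] -/
theorem IsUniformizingElement.valuation_pow_lt_one (hϖ : IsUniformizingElement ϖ) {m : ℕ}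
    (hm : 1 ≤ m) : valuation F ϖ ^ m < 1 :=
  pow_lt_one₀ zero_le hϖ.valuation_lt_one (by omega)

/-- `ϖ^d ∈ 𝒪` for `d ≥ 0` (`d ∈ ℤ`). [folklore] -/
theorem IsUniformizingElement.zpow_mem (hϖ : IsUniformizingElement ϖ) {d : ℤ} (hd : 0 ≤ d) :
    ϖ ^ d ∈ 𝒪[F] := by
  obtain ⟨k, rfl⟩ := Int.eq_ofNat_of_zero_le hd
  rw [zpow_natCast]
  exact hϖ.pow_mem k

/-- An element of `K_m = congruenceGL n |ϖ|^m` is `1 + ϖ^m X` with `X` integral. [folklore] -/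
theorem exists_eq_one_add_smul_of_mem_congruenceGL (hϖ0 : ϖ ≠ 0) {m : ℕ} {k : GL (Fin n) F}
    (hk : k ∈ congruenceGL n (valuation F ϖ ^ m)) :
    ∃ X : Matrix (Fin n) (Fin n) F, IsIntegralMatrix X ∧
      (k : Matrix (Fin n) (Fin n) F) = 1 + ϖ ^ m • X := by
  have hpow : ϖ ^ m ≠ 0 := pow_ne_zero _ hϖ0
  refine ⟨(ϖ ^ m)⁻¹ • ((k : Matrix (Fin n) (Fin n) F) - 1), fun i j => ?_, ?_⟩
  · rw [Matrix.smul_apply, smul_eq_mul, Valuation.mem_integer_iff, map_mul, map_inv₀, map_pow]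
    have hv : valuation F ϖ ^ m ≠ 0 := pow_ne_zero _ ((Valuation.ne_zero_iff _).mpr hϖ0)
    calc (valuation F ϖ ^ m)⁻¹ * valuation F (((k : Matrix (Fin n) (Fin n) F) - 1) i j)
        ≤ (valuation F ϖ ^ m)⁻¹ * valuation F ϖ ^ m := mul_le_mul_right (hk.2.1 i j) _
      _ = 1 := inv_mul_cancel₀ hv
  · rw [smul_smul, mul_inv_cancel₀ hpow, one_smul, add_sub_cancel]

variable (ϖ) in
/-- The entries of `ϖ^m X` (`X` integral) have valuation `≤ |ϖ|^m`: `1 + ϖ^m X ≡ 1` at level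
`|ϖ|^m`. [folklore] -/
theorem valBound_one_add_smul_sub_one (m : ℕ)
    {X : Matrix (Fin n) (Fin n) F} (hX : IsIntegralMatrix X) :
    ValBound (valuation F ϖ ^ m) (1 + ϖ ^ m • X - 1) := by
  intro i j
  rw [add_sub_cancel_left, Matrix.smul_apply, smul_eq_mul, map_mul, map_pow]
  calc valuation F ϖ ^ m * valuation F (X i j) ≤ valuation F ϖ ^ m * 1 :=
        mul_le_mul_right ((Valuation.mem_integer_iff _ _).mp (hX i j)) _
    _ = valuation F ϖ ^ m := mul_one _

/-- `1 + ϖ^m X` (`X` integral, `m ≥ 1`) has unit determinant. [folklore] -/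
theorem isUnit_det_one_add_smul (hϖ : IsUniformizingElement ϖ) {m : ℕ} (hm : 1 ≤ m)
    {X : Matrix (Fin n) (Fin n) F} (hX : IsIntegralMatrix X) : IsUnit (1 + ϖ ^ m • X).det :=
  (isUnit_det_and_valBound_inv (valBound_one_add_smul_sub_one ϖ m hX)
    (hϖ.valuation_pow_lt_one hm)).1

/-- Conversely, an element of `GL_n(F)` with matrix `1 + ϖ^m X`, `X` integral and `m ≥ 1`,
lies in `K_m` (its inverse is integral and `≡ 1`, `isUnit_det_and_valBound_inv`). [folklore] -/
theorem mem_congruenceGL_of_coe_eq_one_add_smul (hϖ : IsUniformizingElement ϖ) {m : ℕ}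
    (hm : 1 ≤ m) {g : GL (Fin n) F} {X : Matrix (Fin n) (Fin n) F} (hX : IsIntegralMatrix X)
    (hg : (g : Matrix (Fin n) (Fin n) F) = 1 + ϖ ^ m • X) :
    g ∈ congruenceGL n (valuation F ϖ ^ m) := by
  have hγ : valuation F ϖ ^ m < 1 := hϖ.valuation_pow_lt_one hm
  have hval : ValBound (valuation F ϖ ^ m) ((g : Matrix (Fin n) (Fin n) F) - 1) := by
    rw [hg]; exact valBound_one_add_smul_sub_one ϖ m hX
  obtain ⟨-, hinv1, hinvγ⟩ := isUnit_det_and_valBound_inv hval hγ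
  have hcoe : ((g⁻¹ : GL (Fin n) F) : Matrix (Fin n) (Fin n) F) =
      (g : Matrix (Fin n) (Fin n) F)⁻¹ := Matrix.coe_units_inv g
  refine ⟨⟨hval.of_sub_one hγ.le, ?_⟩, hval, ?_⟩
  · rw [hcoe]; exact hinv1
  · rw [hcoe]; exact hinvγ

/-- The element `1 + ϖ^m X ∈ K_m` of `GL_n(F)` defined by an integral matrix `X` (`m ≥ 1`):
Mathlib's `Matrix.GeneralLinearGroup.mk''` lies in `K_m`. [folklore] -/
theorem mk''_one_add_smul_mem_congruenceGL (hϖ : IsUniformizingElement ϖ) {m : ℕ} (hm : 1 ≤ m)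
    {X : Matrix (Fin n) (Fin n) F} (hX : IsIntegralMatrix X) :
    Matrix.GeneralLinearGroup.mk'' (1 + ϖ ^ m • X) (isUnit_det_one_add_smul hϖ hm hX) ∈
      congruenceGL n (valuation F ϖ ^ m) :=
  mem_congruenceGL_of_coe_eq_one_add_smul hϖ hm hX rfl

/-! ### Conjugation by torus elements and the expansion property -/

/-- **Conjugating `K_{m+e}` by `ϖ^a`**: if `k - 1 = ϖ^{m+e} W` with `W` integral and
`a_j ≤ a_i + e` whenever `W_{ij} ≠ 0`, then `ϖ^a k ϖ^{-a} ∈ K_m` (`m ≥ 1`): the entry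
`(ϖ^a k ϖ^{-a} - 1)_{ij} = ϖ^{a_i - a_j + m + e} W_{ij}` is `ϖ^m` times an integer. This covers
the three conjugations of the splitting argument: an upper triangular element by a dominant `a`
(`e = 0`), a lower unitriangular element by an anti-dominant `a` (`e = 0`), and an element of
`K_{2m}` by a torus element of spread `≤ m` (`e = m`). (Casselman (1995), Prop. 1.4.3.)
[folklore] -/
theorem conj_zpowDiagGL_mem_congruenceGL (hϖ : IsUniformizingElement ϖ) {m e : ℕ} (hm : 1 ≤ m)
    (a : Fin n → ℤ) {k : GL (Fin n) F} {W : Matrix (Fin n) (Fin n) F} (hW : IsIntegralMatrix W)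
    (hk : (k : Matrix (Fin n) (Fin n) F) = 1 + ϖ ^ (m + e) • W)
    (ha : ∀ i j, W i j ≠ 0 → a j ≤ a i + e) :
    zpowDiagGL hϖ.ne_zero a * k * (zpowDiagGL hϖ.ne_zero a)⁻¹ ∈
      congruenceGL n (valuation F ϖ ^ m) := by
  -- the conjugate is `1 + ϖ^m Z` with `Z_{ij} = ϖ^{e + a_i - a_j} W_{ij}` integral
  set Z : Matrix (Fin n) (Fin n) F := Matrix.of fun i j => ϖ ^ ((e : ℤ) + a i - a j) * W i j
    with hZ
  have hZint : IsIntegralMatrix Z := by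
    intro i j
    rw [hZ, Matrix.of_apply]
    by_cases hw : W i j = 0
    · rw [hw, mul_zero]; exact Subring.zero_mem _
    · refine Subring.mul_mem _ (hϖ.zpow_mem ?_) (hW i j)
      have := ha i j hw
      omega
  refine mem_congruenceGL_of_coe_eq_one_add_smul hϖ hm hZint ?_
  have hsub : (k : Matrix (Fin n) (Fin n) F) - 1 = ϖ ^ (m + e) • W := by
    rw [hk, add_sub_cancel_left]
  rw [← sub_eq_iff_eq_add']
  ext i j
  rw [coe_zpowDiagGL_mul_mul_inv_sub_one_apply, hsub, Matrix.smul_apply, Matrix.smul_apply, hZ,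
    Matrix.of_apply, smul_eq_mul, smul_eq_mul, pow_add, ← zpow_natCast ϖ e,
    show (e : ℤ) + a i - a j = (e : ℤ) + (a i - a j) by ring, zpow_add₀ hϖ.ne_zero]
  ring

/-- **The expansion property `ϖ^α K_m ϖ^β ⊆ K_m (ϖ^α ϖ^β) K_m` at level `m ≥ 1`**, for
`α, β ∈ ℤⁿ` antitone (dominant for the upper triangular Borel) with `α` of spread at most `m`
(`α_j ≤ α_i + m` for all `i, j`; e.g. `α` with entries in `{-1, 0, 1}` when `m ≥ 2`). Proof:
write `k = 1 + ϖ^m X = k₃ x y` with `x = 1 + ϖ^m X_{≤}` (upper part of `X`),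
`y = 1 + ϖ^m X_{>}` (strictly lower part) and `k₃ = k y⁻¹ x⁻¹ ∈ K_{2m}` (as
`x y - k = ϖ^{2m} X_{≤} X_{>}`); then `ϖ^α k ϖ^β = (ϖ^α k₃ ϖ^{-α})(ϖ^α x ϖ^{-α}) · ϖ^α ϖ^β ·
(ϖ^{-β} y ϖ^β)` with `ϖ^α x ϖ^{-α}, ϖ^{-β} y ϖ^β ∈ K_m` by dominance and `ϖ^α k₃ ϖ^{-α} ∈ K_m` by
the spread condition (`conj_zpowDiagGL_mem_congruenceGL`). Hence
`K_m ϖ^α K_m · K_m ϖ^β K_m = K_m ϖ^{α+β} K_m`, the set-theoretic form of the multiplicativity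
`[K_m ϖ^α K_m][K_m ϖ^β K_m] = c [K_m ϖ^{α+β} K_m]` on the dominant cone (Casselman (1995),
Prop. 1.4.4 and Lemma 4.1.5; Bernstein–Zelevinsky (1976), §3; the level-one case with the full
triangular factorisation is `exists_zpowDiagGL_mul_mul_zpowDiagGL_eq` of
`CongruenceSubgroupFactorization`). [folklore] -/
theorem exists_zpowDiagGL_mul_mul_zpowDiagGL_eq_of_mem_congruenceGL (hϖ : IsUniformizingElement ϖ)
    {m : ℕ} (hm : 1 ≤ m) {α β : Fin n → ℤ} (hα : Antitone α) (hαm : ∀ i j, α j ≤ α i + m)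
    (hβ : Antitone β) {k : GL (Fin n) F} (hk : k ∈ congruenceGL n (valuation F ϖ ^ m)) :
    ∃ k₁ ∈ congruenceGL n (valuation F ϖ ^ m), ∃ k₂ ∈ congruenceGL n (valuation F ϖ ^ m),
      zpowDiagGL hϖ.ne_zero α * k * zpowDiagGL hϖ.ne_zero β =
        k₁ * (zpowDiagGL hϖ.ne_zero α * zpowDiagGL hϖ.ne_zero β) * k₂ := by
  obtain ⟨X, hX, hkX⟩ := exists_eq_one_add_smul_of_mem_congruenceGL hϖ.ne_zero hk
  set a : GL (Fin n) F := zpowDiagGL hϖ.ne_zero α with ha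
  set b : GL (Fin n) F := zpowDiagGL hϖ.ne_zero β with hb
  -- the upper and strictly lower parts of `X`
  set XU : Matrix (Fin n) (Fin n) F := Matrix.of fun i j => if i ≤ j then X i j else 0 with hXU
  set XL : Matrix (Fin n) (Fin n) F := Matrix.of fun i j => if i ≤ j then 0 else X i j with hXL
  have hXUL : XU + XL = X := by
    ext i j
    simp only [hXU, hXL, Matrix.add_apply, Matrix.of_apply]
    split_ifs <;> simp
  have hXUint : IsIntegralMatrix XU := fun i j => by
    simp only [hXU, Matrix.of_apply]
    split_ifs
    · exact hX i j
    · exact Subring.zero_mem _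
  have hXLint : IsIntegralMatrix XL := fun i j => by
    simp only [hXL, Matrix.of_apply]
    split_ifs
    · exact Subring.zero_mem _
    · exact hX i j
  -- the two triangular factors
  set x : GL (Fin n) F := Matrix.GeneralLinearGroup.mk'' (1 + ϖ ^ m • XU)
    (isUnit_det_one_add_smul hϖ hm hXUint) with hx
  set y : GL (Fin n) F := Matrix.GeneralLinearGroup.mk'' (1 + ϖ ^ m • XL)
    (isUnit_det_one_add_smul hϖ hm hXLint) with hy
  have hxcoe : (x : Matrix (Fin n) (Fin n) F) = 1 + ϖ ^ m • XU := rfl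
  have hycoe : (y : Matrix (Fin n) (Fin n) F) = 1 + ϖ ^ m • XL := rfl
  have hxK : x ∈ glInt n F := congruenceGL_le_glInt _ (mk''_one_add_smul_mem_congruenceGL hϖ hm hXUint)
  have hyK : y ∈ glInt n F := congruenceGL_le_glInt _ (mk''_one_add_smul_mem_congruenceGL hϖ hm hXLint)
  -- the error term `k₃ = k y⁻¹ x⁻¹ ∈ K_{2m}`
  set k₃ : GL (Fin n) F := k * y⁻¹ * x⁻¹ with hk₃
  set W : Matrix (Fin n) (Fin n) F := -(XU * XL * ((y⁻¹ : GL (Fin n) F) : Matrix (Fin n) (Fin n) F) *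
    ((x⁻¹ : GL (Fin n) F) : Matrix (Fin n) (Fin n) F)) with hW
  have hWint : IsIntegralMatrix W := by
    intro i j
    rw [hW, Matrix.neg_apply]
    exact Subring.neg_mem _ ((((hXUint.mul hXLint).mul (isIntegralMatrix_inv_of_mem_glInt hyK)).mul
      (isIntegralMatrix_inv_of_mem_glInt hxK)) i j)
  have hk₃W : (k₃ : Matrix (Fin n) (Fin n) F) = 1 + ϖ ^ (m + m) • W := by
    -- `k = x y - ϖ^{2m} X_≤ X_>`
    have hxy : (k : Matrix (Fin n) (Fin n) F) =
        (x : Matrix (Fin n) (Fin n) F) * (y : Matrix (Fin n) (Fin n) F) - ϖ ^ (m + m) • (XU * XL) := by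
      rw [hkX, hxcoe, hycoe, Matrix.add_mul, Matrix.mul_add, Matrix.mul_add, Matrix.one_mul,
        Matrix.mul_one, Matrix.one_mul, Matrix.smul_mul, Matrix.mul_smul, smul_smul, ← pow_add,
        ← hXUL, smul_add]
      abel
    have e1 : (k₃ : Matrix (Fin n) (Fin n) F) = (k : Matrix (Fin n) (Fin n) F) *
        ((y⁻¹ : GL (Fin n) F) : Matrix (Fin n) (Fin n) F) *
        ((x⁻¹ : GL (Fin n) F) : Matrix (Fin n) (Fin n) F) := by
      rw [hk₃, Units.val_mul, Units.val_mul]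
    rw [e1, hxy, Matrix.sub_mul, Matrix.sub_mul, Matrix.mul_assoc (x : Matrix (Fin n) (Fin n) F),
      ← Units.val_mul, mul_inv_cancel, Units.val_one, Matrix.mul_one, ← Units.val_mul,
      mul_inv_cancel, Units.val_one, hW, smul_neg, Matrix.smul_mul, Matrix.smul_mul]
    abel
  -- the factorisation `a k b = (a k₃ a⁻¹)(a x a⁻¹) (a b) (b⁻¹ y b)`
  have hfac : a * k * b = (a * k₃ * a⁻¹) * (a * x * a⁻¹) * (a * b) * (b⁻¹ * y * b) := by
    have : k = k₃ * x * y := by rw [hk₃]; group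
    rw [this]; group
  refine ⟨(a * k₃ * a⁻¹) * (a * x * a⁻¹), Subgroup.mul_mem _ ?_ ?_, b⁻¹ * y * b, ?_, ?_⟩
  · -- `a k₃ a⁻¹ ∈ K_m`: spread of `α` at most `m`
    exact conj_zpowDiagGL_mem_congruenceGL hϖ hm α hWint hk₃W fun i j _ => hαm i j
  · -- `a x a⁻¹ ∈ K_m`: `α` antitone, `X_≤` upper triangular
    refine conj_zpowDiagGL_mem_congruenceGL hϖ (e := 0) hm α hXUint (by rw [add_zero]; exact hxcoe)
      fun i j hij => ?_
    have hle : i ≤ j := by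
      by_contra h
      exact hij (by simp [hXU, h])
    simpa using hα hle
  · -- `b⁻¹ y b ∈ K_m`: `β` antitone, `X_>` strictly lower triangular
    have e : b⁻¹ * y * b = zpowDiagGL hϖ.ne_zero (-β) * y * (zpowDiagGL hϖ.ne_zero (-β))⁻¹ := by
      rw [zpowDiagGL_neg, inv_inv]
    rw [e]
    refine conj_zpowDiagGL_mem_congruenceGL hϖ (e := 0) hm (-β) hXLint
      (by rw [add_zero]; exact hycoe) fun i j hij => ?_
    have hlt : j < i := by
      by_contra h
      exact hij (by simp [hXL, not_lt.mp h])
    simpa using hβ hlt.le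
  · rw [hfac]

end Uniformizer

/-! ### The `K_m` as a neighbourhood basis; `GL_n(F)` is nonarchimedean -/

section Topology

open _root_.Topology Filter

variable [TopologicalSpace F] [IsNonarchimedeanLocalField F]

/-- For a uniformizing element `ϖ`, every neighbourhood of `1` in `GL_n(F)` contains a principal
congruence subgroup `K_m = congruenceGL n |ϖ|^m` with `m ≥ 1` (`exists_congruenceGL_subset`, and
the value group of a local field is archimedean, `exists_pow_lt₀`). [folklore] -/
theorem exists_congruenceGL_pow_subset {ϖ : F} (hϖ : IsUniformizingElement ϖ) {U : Set (GL (Fin n) F)}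
    (hU : U ∈ 𝓝 (1 : GL (Fin n) F)) :
    ∃ m : ℕ, 1 ≤ m ∧ (congruenceGL n (valuation F ϖ ^ m) : Set (GL (Fin n) F)) ⊆ U := by
  obtain ⟨γ, hγ⟩ := exists_congruenceGL_subset hU
  haveI : MulArchimedean (ValueGroupWithZero F) :=
    ValuativeRel.isRankLeOne_iff_mulArchimedean.mp inferInstance
  obtain ⟨m, hm⟩ := exists_pow_lt₀ hϖ.valuation_lt_one γ
  refine ⟨m + 1, by omega, subset_trans ?_ hγ⟩
  refine congruenceGL_mono ((pow_le_pow_right_of_le_one' hϖ.valuation_le_one (by omega)).trans hm.le)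

variable (F n) in
/-- **`GL_n(F)` is a nonarchimedean topological group** for a non-archimedean local field `F`:
the compact open principal congruence subgroups form a neighbourhood basis of `1`
(`exists_congruenceGL_pow_subset`, `isOpen_congruenceGL`). A theorem to be invoked with
`haveI`, not an instance (compare `t2Space_of_isNonarchimedeanLocalField` of
`GodementJacquetLocalNonvanishing`). (Bump (1997), Prop. 4.2.1; Bushnell–Henniart (2006), §1.1.)
[folklore] -/
theorem nonarchimedeanGroup_gl : NonarchimedeanGroup (GL (Fin n) F) where
  is_nonarchimedean U hU := by
    obtain ⟨ϖ, hϖ⟩ := exists_isUniformizingElement (F := F)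
    obtain ⟨m, -, hsub⟩ := exists_congruenceGL_pow_subset hϖ hU
    exact ⟨⟨congruenceGL n (valuation F ϖ ^ m), isOpen_congruenceGL
      (pow_ne_zero _ ((Valuation.ne_zero_iff _).mpr hϖ.ne_zero))⟩, hsub⟩

end Topology

end Literature.NumberTheory.Automorphic
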